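import Summits.BirchSwinnertonDyer.BirchSwinnertonDyer.Theorems.ManinLocalTwoThreeManinPrimeToThreeAtNineOfRatThreeTorsion
import Summits.BirchSwinnertonDyer.Rank1Residual.ManinAdditive.UDCKummerLine
import HarnessLib

/-!
# The UDC line of C3 THREADED AT `9 ∣ N`: `ReducibleCaseAtNine` ⟸ TypeII ∧ NC-a ∧ NC-b@9 ∧ BI ∧ AN, and C3 ⟸ F₃ ∧ (those) ∧ RES₃♭
Summit `BirchSwinnertonDyer`, route `ManinLocalTwoThree` (cell bsd-f2-manin), crux C3 `ManinPrimeToThreeAtNine` (stmt-BirchSwinnertonDyer-22968);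
lead p1 gen 15.  -an g37's UDC line (`…/ManinAdditive/UDCKummerLine.lean`, MEMO-an §80.12) proves `reducibleCaseAtNine_of_udc : NC → BI →
AN → ReducibleCaseAtNine` with LEVEL-FREE (NC).  The kernel proofs of the pieces live at `9 ∣ N` (p3's NC-b uses the lead's `9 ∣ N`
μ₃-type theorem `no_rational_kernel_generator`), and `ReducibleCaseAtNine` itself carries `9 ∣ N`; so the composition is re-threaded here
with every NC-type hypothesis RESTRICTED to `9 ∣ N`:
* §1 `Gamma_le_Gamma0`, `Gamma_mul_le_left/right` (bookkeeping: `Γ(M) ≤ Γ₀(M)`, `Γ(MK) ≤ Γ(M), Γ(K)`);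
* §2 **`kummerCoverNoncongruence_nine_of_pieces`** — TypeII (cite) ∧ NC-a (`KummerCoverSubgroup`, a THEOREM: `…KummerCoverSubgroup.lean`)
  ∧ NC-b@9 ⟹ NC@9 (glue `Γ(MN) ≤ Γ₀(N) ∩ Γ(M)`);
* §3 **`reducibleCaseAtNine_of_udc_nine`** — NC@9 ∧ BI ∧ AN ⟹ `ReducibleCaseAtNine` (-an's six lines with `9 ∣ N` threaded);
  **`ratThreeTorsion_of_reducibleCaseAtNine`** — ⟹ RAT₃ (germ by `exists_isParamGerm`);
* §4 **`maninPrimeToThreeAtNine_of_katoFactKP_of_udcNine_of_coprimeIsolated`** — C3 ⟸ F₃♮ ∧ [∀k UDC_k ∧ TypeII] (cite) ∧ NC-a ∧ NC-b@9 ∧ BI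
  ∧ AN♮ ∧ RES₃♭ — the composition of skeleton v21 of `kato_shift_three`.
HONEST FRAMING: CONDITIONAL compositions; UDC (Calegari–Dimitrov–Tang 2025) and Kurth–Long Prop. 18 are printed, statement-only inputs; AN♮,
NC-b, RES₃♭ OPEN; F₃♮ printed Kato fact; C3, Manin's conjecture and BSD are NOT proved.  No definitions, no sorry.
[cite: CalegariDimitrovTang2025, Thm. 1.0.1] [cite: KurthLong2008, Prop. 18] [cite: Kato2004Asterisque, Thm. 9.7 (p. 189)]
-/

set_option autoImplicit false
-- the summit-side namespace `Summit.BirchSwinnertonDyer.BirchSwinnertonDyer.…` is the tree's (summit = sub-problem)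
set_option linter.dupNamespace false

noncomputable section

open scoped Classical MatrixGroups ModularForm
open PowerSeries CongruenceSubgroup
open WeierstrassCurve Literature.NumberTheory.EllipticCurves Literature.NumberTheory.EllipticCurves.ModularForms
open Summit.BirchSwinnertonDyer.Rank1Residual.ManinAdditive
open Summit.BirchSwinnertonDyer.Rank1Residual.ManinAdditive.CuspidalKummer
open Summit.BirchSwinnertonDyer.Rank1Residual.ManinAdditive.CuspidalKummerThree
open Summit.BirchSwinnertonDyer.Rank1Residual.ManinAdditive.UDCKummerLine

namespace Summit.BirchSwinnertonDyer.BirchSwinnertonDyer.Theorems.ManinLocalTwoThree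

/-! ## §1 Congruence-subgroup bookkeeping -/

/-- `Γ(M) ≤ Γ₀(M)`. [cite: DiamondShurman2005, §1.2] -/
theorem Gamma_le_Gamma0 (M : ℕ) : CongruenceSubgroup.Gamma M ≤ Gamma0 M := by
  intro γ hγ
  rw [Gamma_mem] at hγ
  rw [Gamma0_mem]
  exact hγ.2.2.1

/-- `Γ(MK) ≤ Γ(M)`. [cite: DiamondShurman2005, §1.2] -/
theorem Gamma_mul_le_left (M K : ℕ) : CongruenceSubgroup.Gamma (M * K) ≤ CongruenceSubgroup.Gamma M := by
  intro γ hγ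
  rw [Gamma_mem] at hγ ⊢
  obtain ⟨h00, h01, h10, h11⟩ := hγ
  have cast : ∀ {x : ℤ} {y : ZMod (M * K)}, ((x : ZMod (M * K)) = y) →
      ((x : ZMod M)) = ZMod.castHom (dvd_mul_right M K) (ZMod M) y := fun {x y} h ↦ by
    rw [← h, map_intCast]
  refine ⟨?_, ?_, ?_, ?_⟩
  · rw [cast h00, map_one]
  · rw [cast h01, map_zero]
  · rw [cast h10, map_zero]
  · rw [cast h11, map_one]

/-- `Γ(MK) ≤ Γ(K)`. [cite: DiamondShurman2005, §1.2] -/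
theorem Gamma_mul_le_right (M K : ℕ) : CongruenceSubgroup.Gamma (M * K) ≤ CongruenceSubgroup.Gamma K := by
  rw [mul_comm]; exact Gamma_mul_le_left K M

/-! ## §2 NC at `9 ∣ N` from the pieces -/

/-- **NC@9 ⟸ TypeII ∧ NC-a ∧ NC-b@9.**  With `Γ_T` the subgroup of NC-a (finite index, normal in `Γ₀(N)`, contains the trace-`±2`
elements), NC-b@9 gives `Γ₁(N) ⊄ Γ_T`, Kurth–Long's type-II criterion gives `Γ(M′) ⊄ Γ_T` for every `M′`, and with `M′ = MN`
(`Γ(MN) ≤ Γ₀(N) ∩ Γ(M)`) an element of `Γ₀(N) ∩ Γ(M)` outside `Γ_T`.  CONDITIONAL. [cite: KurthLong2008, Prop. 18] -/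
theorem kummerCoverNoncongruence_nine_of_pieces (hII : TypeIINoncongruence) (hNa : KummerCoverSubgroup)
    (hNb : ∀ (W : WeierstrassCurve ℚ) [W.IsElliptic] [W.IsGloballyMinimal] {N : ℕ} [NeZero N]
      (D : ModularParametrizationData W N),
      (∀ z ∈ D.L.lattice, ∃ w ∈ periodLattice D.f, z = D.c * w) → 9 ∣ N →
      ∀ X₀ Y₀ : ℚ, IsShortThreeTorsion W D.c X₀ Y₀ →
      ∀ u : ℂ, u ∉ D.L.lattice → 3 * u ∈ D.L.lattice →
      (D.c : ℂ) ^ 2 * D.L.weierstrassP u = (X₀ : ℂ) → (D.c : ℂ) ^ 3 * D.L.derivWeierstrassP u / 2 = (Y₀ : ℂ) →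
      ∃ γ : Gamma0 N, (γ : SL(2, ℤ)) ∈ Gamma1 N ∧ ¬ KummerPeriodTrivial D u γ) :
    ∀ (W : WeierstrassCurve ℚ) [W.IsElliptic] [W.IsGloballyMinimal] {N : ℕ} [NeZero N]
      (D : ModularParametrizationData W N),
      (∀ z ∈ D.L.lattice, ∃ w ∈ periodLattice D.f, z = D.c * w) → 9 ∣ N →
      ∀ X₀ Y₀ : ℚ, IsShortThreeTorsion W D.c X₀ Y₀ →
      ∀ u : ℂ, u ∉ D.L.lattice → 3 * u ∈ D.L.lattice →
      (D.c : ℂ) ^ 2 * D.L.weierstrassP u = (X₀ : ℂ) → (D.c : ℂ) ^ 3 * D.L.derivWeierstrassP u / 2 = (Y₀ : ℂ) →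
      ∀ M : ℕ, 0 < M → ∃ γ : Gamma0 N, (γ : SL(2, ℤ)) ∈ CongruenceSubgroup.Gamma M ∧ ¬ KummerPeriodTrivial D u γ := by
  intro W _ _ N _ D hopt h9 X₀ Y₀ hT u hu h3u hX hY M hM
  obtain ⟨Γ, hmem, hle, hfi, hnorm, htr⟩ := hNa W D hopt u hu h3u
  obtain ⟨γ₁, hγ₁, hne⟩ := hNb W D hopt h9 X₀ Y₀ hT u hu h3u hX hY
  have hnot1 : ¬ (Gamma1 N ≤ Γ) := fun hle1 ↦ hne ((hmem γ₁).mp (hle1 hγ₁))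
  have hN : 0 < N := Nat.pos_of_ne_zero (NeZero.ne N)
  have hMN : 0 < M * N := Nat.mul_pos hM hN
  have hnotM := hII N hN Γ hfi hle hnorm htr hnot1 (M * N) hMN
  obtain ⟨g, hgM, hgΓ⟩ : ∃ g ∈ CongruenceSubgroup.Gamma (M * N), g ∉ Γ := by
    by_contra h
    push Not at h
    exact hnotM h
  have hg0 : g ∈ Gamma0 N := Gamma_le_Gamma0 N (Gamma_mul_le_right M N hgM)
  refine ⟨⟨g, hg0⟩, Gamma_mul_le_left M N hgM, fun hK ↦ hgΓ ((hmem ⟨g, hg0⟩).mpr hK)⟩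

/-! ## §3 The reducible case at `9 ∣ N`, and RAT₃ -/

open Summit.BirchSwinnertonDyer.BirchSwinnertonDyer.Theorems.ManinLocalTwoThree.KummerCubeSigmaLeaves in
/-- **NC@9 ∧ BI ∧ AN ⟹ `ReducibleCaseAtNine`** (-an's assembly with `9 ∣ N` threaded into NC). CONDITIONAL. [folklore] -/
theorem reducibleCaseAtNine_of_udc_nine
    (hNC : ∀ (W : WeierstrassCurve ℚ) [W.IsElliptic] [W.IsGloballyMinimal] {N : ℕ} [NeZero N]
      (D : ModularParametrizationData W N),
      (∀ z ∈ D.L.lattice, ∃ w ∈ periodLattice D.f, z = D.c * w) → 9 ∣ N →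
      ∀ X₀ Y₀ : ℚ, IsShortThreeTorsion W D.c X₀ Y₀ →
      ∀ u : ℂ, u ∉ D.L.lattice → 3 * u ∈ D.L.lattice →
      (D.c : ℂ) ^ 2 * D.L.weierstrassP u = (X₀ : ℂ) → (D.c : ℂ) ^ 3 * D.L.derivWeierstrassP u / 2 = (Y₀ : ℂ) →
      ∀ M : ℕ, 0 < M → ∃ γ : Gamma0 N, (γ : SL(2, ℤ)) ∈ CongruenceSubgroup.Gamma M ∧ ¬ KummerPeriodTrivial D u γ)
    (hBI : KummerCubeRootThreeBounded) (hAN : KummerCubeRootCongruenceOfBounded) : ReducibleCaseAtNine := by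
  intro W _ _ N _ D a ha h9 hopt X₀ Y₀ hT z hz h3
  obtain ⟨-, u, hu₁, hu₂, -, hX, hY⟩ := shortThreeTorsionLift W D X₀ Y₀ hT
  obtain ⟨h, hh3, hh0, hK⟩ := hBI W D a ha h9 X₀ Y₀ hT z hz h3
  obtain ⟨M, hM, hcong⟩ := hAN W D a ha hopt X₀ Y₀ hT u hu₁ hu₂ hX hY z hz h hh3 hh0 hK
  obtain ⟨γ, hγ, hne⟩ := hNC W D hopt h9 X₀ Y₀ hT u hu₁ hu₂ hX hY M hM
  exact hne (hcong γ hγ)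

/-- **`ReducibleCaseAtNine` ⟹ RAT₃** (germ-free: the formal parametrisation germ exists, `exists_isParamGerm`). [folklore] -/
theorem ratThreeTorsion_of_reducibleCaseAtNine (h : ReducibleCaseAtNine) :
    ∀ (B : WeierstrassCurve ℚ) [B.IsElliptic] [B.IsGloballyMinimal] {M : ℕ} [NeZero M]
      (DB : ModularParametrizationData B M), 9 ∣ M →
      (∀ z ∈ DB.L.lattice, ∃ w ∈ periodLattice DB.f, z = DB.c * w) →
      ∀ X₀ Y₀ : ℚ, IsShortThreeTorsion B DB.c X₀ Y₀ → ¬ (3 : ℤ) ∣ DB.c := by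
  intro B _ _ M _ DB h9 hL X₀ Y₀ hT
  set a : ℕ → ℤ := fun n ↦ B.LFunction n with ha_def
  have ha : ∀ n, (a n : ℂ) = cuspCoeff DB.f n := fun n ↦ (DB.isNewformOf.2 n).symm
  obtain ⟨z, hz⟩ := exists_isParamGerm B DB.c a
  exact h B DB a ha h9 hL X₀ Y₀ hT z hz

/-! ## §4 The composition of skeleton v21 -/

/-- **C3 ⟸ F₃♮ ∧ [UDC (all weights) ∧ TypeII] ∧ NC-a ∧ NC-b@9 ∧ BI ∧ AN♮ ∧ RES₃♭** — skeleton v21 of `kato_shift_three`, composed through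
RAT₃ (`…_of_katoFactKP_of_ratThreeTorsion_of_coprimeIsolated`).  CONDITIONAL; C3 OPEN; BSD not proved.
[cite: CalegariDimitrovTang2025, Thm. 1.0.1] [cite: KurthLong2008, Prop. 18] [cite: Kato2004Asterisque, Thm. 9.7 (p. 189)] -/
theorem maninPrimeToThreeAtNine_of_katoFactKP_of_udcNine_of_coprimeIsolated
    (hK : kato_neron_isIntegral_twistedSymbolSum_of_additive_three_kp)
    (hPrint : (∀ k : ℤ, UnboundedDenominatorsWeight k) ∧ TypeIINoncongruence)
    (hNa : KummerCoverSubgroup)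
    (hNb : ∀ (W : WeierstrassCurve ℚ) [W.IsElliptic] [W.IsGloballyMinimal] {N : ℕ} [NeZero N]
      (D : ModularParametrizationData W N),
      (∀ z ∈ D.L.lattice, ∃ w ∈ periodLattice D.f, z = D.c * w) → 9 ∣ N →
      ∀ X₀ Y₀ : ℚ, IsShortThreeTorsion W D.c X₀ Y₀ →
      ∀ u : ℂ, u ∉ D.L.lattice → 3 * u ∈ D.L.lattice →
      (D.c : ℂ) ^ 2 * D.L.weierstrassP u = (X₀ : ℂ) → (D.c : ℂ) ^ 3 * D.L.derivWeierstrassP u / 2 = (Y₀ : ℂ) →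
      ∃ γ : Gamma0 N, (γ : SL(2, ℤ)) ∈ Gamma1 N ∧ ¬ KummerPeriodTrivial D u γ)
    (hBI : KummerCubeRootThreeBounded) (hAN : KummerCubeRootCongruenceOfBoundedOfUDC)
    (hRes : NoRationalThreeTorsionCoprimeIsolatedResidual) :
    Summit.BirchSwinnertonDyer.BirchSwinnertonDyer.Theses.ManinLocalTwoThree.ManinPrimeToThreeAtNine :=
  maninPrimeToThreeAtNine_of_katoFactKP_of_ratThreeTorsion_of_coprimeIsolated hK
    (ratThreeTorsion_of_reducibleCaseAtNine
      (reducibleCaseAtNine_of_udc_nine (kummerCoverNoncongruence_nine_of_pieces hPrint.2 hNa hNb) hBI (hAN hPrint.1)))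
    hRes

end Summit.BirchSwinnertonDyer.BirchSwinnertonDyer.Theorems.ManinLocalTwoThree

end
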